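import Summits.CriticalPhenomena.PercolationContinuityZ3.Theorems.PercNearOneGluingNoHeavyLowerTailSahiThreeCopyLawBack

/-!
# `NoHeavyLowerTail` (crux stmt-CriticalPhenomena-4575), Sahi programme: **LAW-LEVEL GOODNESS UNDER RELABELLING AND FREEZING OF FRONT
# COORDINATES** (the `LawGood` twins of `frontGood_relab`, `frontGood_cons_zero/three`, `frontGood_of_four_le`)

Support file (Sahi cell, seat `prim-sahi-p1`, generation 65; `--supports stmt-CriticalPhenomena-4575`); companion of `…SahiThreeCopyLawBack` (gen 64:
`LawGood`, `lawGood_of_frontGood`) and `…SahiThreeCopyTwoPointFront` (gen 61: `relab`, `liftPerm`, `appendProf_comp_liftPerm`,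
`frontFn_comp_relab_liftPerm`, `sec_frontFn_succ`).  Pure bookkeeping; no `sorry`, standard axioms.

CONTENT.  To assemble `E₃ ≥ 0` for a slot on the whole cube from `LawGood` at every front profile (`sahiE_three_coin_frontFn_nonneg_of_lawGood`)
one needs `LawGood` at ALL profiles `π : Fin k → ℕ`; profiles are reduced to class representatives by ★ `lawGood_relab`
(`LawGood k π (f ∘ relab σ) → LawGood k (π ∘ σ) f`), entries `0` / `3` are frozen by ★ `lawGood_cons_zero` / ★ `lawGood_cons_three`
(reduce to the bottom / top section of the slot on `k` coordinates), and entries `≥ 4` are empty (`lawGood_of_four_le`). [this work]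
-/

namespace Summit.CriticalPhenomena.PercolationContinuityZ3.Theorems.SahiThreeCopy

open Finset Function Literature.Combinatorics.Sahi2008
open scoped BigOperators

variable {k : ℕ}

/-- ★ **Relabelling transfer for law-level goodness**: `LawGood k π (f ∘ relab σ) → LawGood k (π ∘ σ) f` (the back block is untouched;
mirror of `frontGood_relab`). [this work] -/
theorem lawGood_relab (σ : Equiv.Perm (Fin k)) {π : Fin k → ℕ} {f : Pt k → ℝ} (h : LawGood k π (f ∘ relab σ)) :
    LawGood k (π ∘ σ) f := by
  intro d q hq G H hG hG1 hH hH1 hGm hHm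
  have key : ∀ b : Fin d → Fin 4, tc (appendProf k (π ∘ σ) (fun i => ((b i : Fin 4) : ℕ))) (frontFn k f) G H =
      tc (appendProf k π (fun i => ((b i : Fin 4) : ℕ))) (frontFn k (f ∘ relab σ)) (G ∘ relab (liftPerm d k σ))
        (H ∘ relab (liftPerm d k σ)) := by
    intro b
    rw [← appendProf_comp_liftPerm, tc_relab, frontFn_comp_relab_liftPerm]
  simp only [key]
  exact h q hq (fun w => hG _) (fun w => hG1 _) (fun w => hH _) (fun w => hH1 _) (monotone_comp_relab _ hGm)
    (monotone_comp_relab _ hHm)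

/-- ★ Frozen front coordinate `0` at `0` (profile entry `0`): law-level goodness reduces to the bottom section of the slot. [this work] -/
theorem lawGood_cons_zero {π : Fin (k + 1) → ℕ} (h0 : π 0 = 0) {f : Pt (k + 1) → ℝ}
    (hf : LawGood k (Fin.tail π) (fun e => f (Fin.cons false e))) : LawGood (k + 1) π f := by
  intro d q hq G H hG hG1 hH hH1 hGm hHm
  have key : ∀ b : Fin d → Fin 4, tc (appendProf (k + 1) π (fun i => ((b i : Fin 4) : ℕ))) (frontFn (k + 1) f) G H =
      tc (appendProf k (Fin.tail π) (fun i => ((b i : Fin 4) : ℕ))) (frontFn k (fun e => f (Fin.cons false e))) (sec G false) (sec H false) := by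
    intro b; rw [appendProf_succ, h0, tc_cons_zero, sec_frontFn_succ]
  simp only [key]
  exact hf q hq (sec_nonneg hG _) (fun w => hG1 _) (sec_nonneg hH _) (fun w => hH1 _) (sec_monotone hGm _) (sec_monotone hHm _)

/-- ★ Frozen front coordinate `0` at `1` (profile entry `3`): law-level goodness reduces to the top section of the slot. [this work] -/
theorem lawGood_cons_three {π : Fin (k + 1) → ℕ} (h3 : π 0 = 3) {f : Pt (k + 1) → ℝ}
    (hf : LawGood k (Fin.tail π) (fun e => f (Fin.cons true e))) : LawGood (k + 1) π f := by
  intro d q hq G H hG hG1 hH hH1 hGm hHm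
  have key : ∀ b : Fin d → Fin 4, tc (appendProf (k + 1) π (fun i => ((b i : Fin 4) : ℕ))) (frontFn (k + 1) f) G H =
      tc (appendProf k (Fin.tail π) (fun i => ((b i : Fin 4) : ℕ))) (frontFn k (fun e => f (Fin.cons true e))) (sec G true) (sec H true) := by
    intro b; rw [appendProf_succ, h3, tc_cons_three, sec_frontFn_succ]
  simp only [key]
  exact hf q hq (sec_nonneg hG _) (fun w => hG1 _) (sec_nonneg hH _) (fun w => hH1 _) (sec_monotone hGm _) (sec_monotone hHm _)

/-- A front profile entry `≥ 4` has no arrangements: law-level goodness is trivial. [this work] -/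
theorem lawGood_of_four_le (π : Fin k → ℕ) {i : Fin k} (hi : 4 ≤ π i) (f : Pt k → ℝ) : LawGood k π f :=
  lawGood_of_frontGood (frontGood_of_four_le π hi f)

end Summit.CriticalPhenomena.PercolationContinuityZ3.Theorems.SahiThreeCopy
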